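import Summits.QuantumAdvantage.QuantumAdvantage.Theorems.LengthDialC

/-!
# LengthDial, part D/7 (§7–§8: XOR-closed cut classes (`CutClass.twoLengths`) and the complement symmetry `u ↦ ū` (one charge class suffices: R_off ⟺ R_one)) — support for item stmt-QuantumAdvantage-28401 (`Theses.AbsorptionDial.MassHiQuasi`)

Cell decomp-qadv, seat lens-5 («finite range + asymptotic regime + bridge»), generation 26 — land port of the node
«LengthDial» (published under the cell's HOME/decomp-qadv-lens-5/g26/LengthDial.lean, record NODE-g26.md; RESIDUAL MODE on
AbsorptionDial:28401 `MassHiQuasi`).  The node file with ONLY the namespace renamed `Theses.LengthDial → Theorems.LengthDial`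
and split at section boundaries into parts A–G (each importing the previous; part G alone imports the route file
Theses.AbsorptionDial for the BY-NAME equivalences and `closes`).  Prop-defs = the node's hardness predicates / grades only.
Tree facts reused by name, not restated: `RigidityLaws.walkExp_zero/self`, `RigidityLaws.ringWinU_congr_mod`,
`RigidityLaws.threeCharge`, `RigidityLaws.hasDegF_xor`, `FibreDial.const_of_hasDegF_zero`, `WalkCoreBasics.ringWinU_compl`, `chargeRecursion`, `sliceAt_mem_lowDeg`,
`Smolensky.comp_mem_lowDeg_of_coord`.  No `sorry`, no new axioms, no instances, no notation.
-/

set_option autoImplicit false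
set_option linter.unusedVariables false
set_option linter.dupNamespace false
set_option linter.style.longLine false

namespace Summit.QuantumAdvantage.QuantumAdvantage.Theorems.LengthDial

open Finset
open Summit.QuantumAdvantage.AdviceFreeQNC0
open Literature.Computability.MetaComplexity Literature.Computability.MetaComplexity.Smolensky

/-! ## §7 XOR-closed classes: two consecutive lengths bound all later lengths -/

section XorClosed

/-- a strategy CLASS: a predicate on cut functions at every length. -/
structure CutClass where
  mem : ∀ {n : ℕ}, ((Fin n → Bool) → Bool) → Prop
  /-- closed under restriction to a face -/
  cons_mem : ∀ {n : ℕ} (b : Bool) (f : (Fin (n + 1) → Bool) → Bool), mem f → mem fun v => f (Fin.cons b v)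
  /-- closed under XOR -/
  xor_mem : ∀ {n : ℕ} (f g : (Fin n → Bool) → Bool), mem f → mem g → mem fun u => xor (f u) (g u)
  /-- contains the constant `false` -/
  false_mem : ∀ {n : ℕ}, mem fun _ : Fin n → Bool => false

variable (𝒞 : CutClass)

/-- an XOR-closed cut class is closed under `α ∧ ·` for constant `α`. -/
theorem CutClass.constAnd_mem {n : ℕ} (α : Bool) {e : (Fin n → Bool) → Bool} (he : 𝒞.mem e) :
    𝒞.mem fun u => α && e u := by
  cases α
  · simp only [Bool.false_and]; exact 𝒞.false_mem
  · simp only [Bool.true_and]; exact he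

/-- an XOR-closed cut class is closed under merging. -/
theorem CutClass.merge_mem {m : ℕ} (r c : ℕ) {e : (Fin m → Bool) → Bool}
    {z : Fin (m + 1) → (Fin m → Bool) → Bool} (he : 𝒞.mem e) (hz : ∀ g, 𝒞.mem (z g)) (g : Fin (m + 1)) :
    𝒞.mem (merge r c e z g) := by
  unfold merge
  exact 𝒞.xor_mem _ _ (𝒞.xor_mem _ _ (hz g) (𝒞.constAnd_mem _ he)) (𝒞.constAnd_mem _ he)

/-- an XOR-closed cut class is closed under the one-bit peel. -/
theorem CutClass.peel1_mem {n : ℕ} (c : ℕ) (b : Bool) {y : Fin (n + 2) → (Fin (n + 1) → Bool) → Bool}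
    (hy : ∀ g, 𝒞.mem (y g)) (g : Fin (n + 1)) : 𝒞.mem (peel1 c b y g) :=
  𝒞.merge_mem _ _ (𝒞.cons_mem b _ (hy 0)) (fun h => 𝒞.cons_mem b _ (hy h.succ)) g

/-- an XOR-closed cut class is closed under the two-bit peel. -/
theorem CutClass.peel2_mem {k : ℕ} (c : ℕ) (b b' : Bool) {y : Fin (k + 3) → (Fin (k + 2) → Bool) → Bool}
    (hy : ∀ g, 𝒞.mem (y g)) (g : Fin (k + 1)) : 𝒞.mem (peel2 c b b' y g) := by
  have hy' : ∀ h, 𝒞.mem (tailStrat b y h) := fun h => 𝒞.cons_mem b _ (hy h.succ)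
  refine 𝒞.merge_mem _ _ (𝒞.cons_mem b' _ (𝒞.cons_mem b _ (hy 0))) (fun h => ?_) g
  exact 𝒞.merge_mem _ _ (𝒞.cons_mem b' _ (hy' 0)) (fun h' => 𝒞.cons_mem b' _ (hy' h'.succ)) h

/-- class value bound at length `m`, all charges. -/
def CutClass.ClassHard (𝒞 : CutClass) (m : ℕ) (θ : ℝ) : Prop :=
  ∀ c : ℕ, ∀ y : Fin (m + 1) → (Fin m → Bool) → Bool, (∀ g, 𝒞.mem (y g)) → (winCount m c y : ℝ) ≤ θ * 2 ^ m

/-- class value bound at length `m`, off-diagonal charges. -/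
def CutClass.ClassOffHard (𝒞 : CutClass) (m : ℕ) (θ : ℝ) : Prop :=
  ∀ c : ℕ, c % 3 ≠ m % 3 → ∀ y : Fin (m + 1) → (Fin m → Bool) → Bool, (∀ g, 𝒞.mem (y g)) →
    (winCount m c y : ℝ) ≤ θ * 2 ^ m

/-- the length law for an XOR-closed class: NO degree loss. -/
theorem CutClass.classLaw {k : ℕ} {θ : ℝ} (h1 : 𝒞.ClassOffHard (k + 1) θ) (h0 : 𝒞.ClassOffHard k θ) :
    𝒞.ClassHard (k + 2) θ := by
  intro c y hy
  have face : ∀ b : Bool,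
      ((if c1 c b % 3 ≠ (k + 1) % 3 then winCount (k + 1) (c1 c b) (peel1 c b y)
        else ∑ b' : Bool, winCount k (c2 c b b') (peel2 c b b' y) : ℕ) : ℝ) ≤ θ * 2 ^ (k + 1) := by
    intro b
    split_ifs with hgood
    · exact h1 (c1 c b) hgood (peel1 c b y) (𝒞.peel1_mem c b hy)
    · push Not at hgood
      rw [Nat.cast_sum]
      calc ∑ b' : Bool, (winCount k (c2 c b b') (peel2 c b b' y) : ℝ)
          ≤ ∑ b' : Bool, θ * 2 ^ k :=
            Finset.sum_le_sum fun b' _ => h0 _ (c2_offDiag c k b b' hgood) _ (𝒞.peel2_mem c b b' hy)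
        _ = θ * 2 ^ (k + 1) := by rw [Finset.sum_const, Finset.card_univ, Fintype.card_bool]; ring
  rw [winCount_peel, Nat.cast_sum]
  calc ∑ b : Bool, ((if c1 c b % 3 ≠ (k + 1) % 3 then winCount (k + 1) (c1 c b) (peel1 c b y)
        else ∑ b' : Bool, winCount k (c2 c b b') (peel2 c b b' y) : ℕ) : ℝ)
      ≤ ∑ b : Bool, θ * 2 ^ (k + 1) := Finset.sum_le_sum fun b _ => face b
    _ = θ * 2 ^ (k + 2) := by rw [Finset.sum_const, Finset.card_univ, Fintype.card_bool]; ring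

/-- **TWO CONSECUTIVE LENGTHS BOUND ALL LATER LENGTHS** (finite range `{m, m+1}` + bridge ⟹ the whole
asymptotic regime, exactly, for every XOR-closed restriction-closed strategy class). -/
theorem CutClass.twoLengths {m : ℕ} {θ : ℝ} (hm : 𝒞.ClassOffHard m θ) (hm1 : 𝒞.ClassOffHard (m + 1) θ) :
    ∀ n, m + 2 ≤ n → 𝒞.ClassHard n θ := by
  have inv : ∀ t : ℕ, 𝒞.ClassOffHard (m + t) θ ∧ 𝒞.ClassOffHard (m + t + 1) θ := by
    intro t
    induction t with
    | zero => exact ⟨hm, hm1⟩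
    | succ t ih =>
      obtain ⟨ha, hb⟩ := ih
      refine ⟨by simpa [Nat.add_assoc] using hb, ?_⟩
      have hc : 𝒞.ClassHard (m + t + 2) θ := 𝒞.classLaw hb ha
      have : 𝒞.ClassOffHard (m + t + 2) θ := fun c _ y hy => hc c y hy
      simpa [Nat.add_assoc] using this
  intro n hn
  obtain ⟨t, rfl⟩ : ∃ t, n = m + t + 2 := ⟨n - m - 2, by omega⟩
  obtain ⟨ha, hb⟩ := inv t
  exact 𝒞.classLaw hb ha

end XorClosed



/-! ## §8 The complement symmetry `u ↦ ū`: one charge class suffices -/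

section Complement
variable {n : ℕ}

/-- the strategy pre-composed with complementation. -/
def complStrat (y : Fin (n + 1) → (Fin n → Bool) → Bool) : Fin (n + 1) → (Fin n → Bool) → Bool :=
  fun g v => y g (fun i => !v i)

/-- **COMPLEMENT SYMMETRY** (the tree's `WalkCoreBasics.ringWinU_compl : RingWinUCompl`, in `complStrat` form):
`y` on `ū` at charge `c` is `y ∘ compl` on `u` at charge `2c + 2n` (mod 3 this swaps the two off-diagonal classes
`c ≡ n+1 ↔ c ≡ n+2` and fixes the diagonal). -/
theorem ringWinU_complStrat (c : ℕ) (y : Fin (n + 1) → (Fin n → Bool) → Bool) (u : Fin n → Bool) :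
    ringWinU c y (fun i => !u i) = ringWinU (2 * c + 2 * n) (complStrat y) u :=
  AdviceFreeQNC0.ringWinU_compl n c (2 * c + 2 * n) (by omega) y u

/-- the win count only depends on the charge mod `3` (tree: `RigidityLaws.ringWinU_congr_mod`). -/
theorem winCount_charge_mod {c c' : ℕ} (h : c % 3 = c' % 3) (y : Fin (n + 1) → (Fin n → Bool) → Bool) :
    winCount n c y = winCount n c' y := by
  unfold winCount
  simp_rw [RigidityLaws.ringWinU_congr_mod _ _ h]

/-- win count of the complemented strategy = win count at the dual charge `2c + 2n`. -/
theorem winCount_complStrat (c : ℕ) (y : Fin (n + 1) → (Fin n → Bool) → Bool) :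
    winCount n c (complStrat y) = winCount n (2 * c + 2 * n) y := by
  unfold winCount
  have e : complStrat (complStrat y) = y := by
    funext g v; simp [complStrat]
  refine Finset.card_bij (fun u _ => fun i => !u i) ?_ ?_ ?_
  · intro u hu
    rw [mem_filter] at hu ⊢
    refine ⟨mem_univ _, ?_⟩
    rw [ringWinU_complStrat, RigidityLaws.ringWinU_congr_mod _ _ (show (2 * (2 * c + 2 * n) + 2 * n) % 3 = c % 3 by omega)]
    exact hu.2
  · intro u₁ _ u₂ _ h
    funext i
    have := congrFun h i
    simpa using this
  · intro w hw
    refine ⟨fun i => !w i, ?_, ?_⟩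
    · rw [mem_filter] at hw ⊢
      refine ⟨mem_univ _, ?_⟩
      rw [ringWinU_complStrat, e]
      exact hw.2
    · funext i; simp

variable {p : ℕ} [Fact p.Prime]

/-- complementation of the inputs is an affine substitution: degree is preserved. -/
theorem hasDegF_complArg {D : ℕ} {f : (Fin n → Bool) → Bool} (hf : HasDegF p f D) :
    HasDegF p (fun v => f (fun i => !v i)) D := by
  unfold HasDegF at *
  refine Smolensky.comp_mem_lowDeg_of_coord (F := ZMod p) (fun (v : Fin n → Bool) (i : Fin n) => !v i) (fun i => ?_) hf
  have h : (fun u : Fin n → Bool => if (!u i) = true then (1 : ZMod p) else 0)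
      = mono (ZMod p) (∅ : Finset (Fin n)) - mono (ZMod p) {i} := by
    funext u
    simp only [Pi.sub_apply, mono_apply, Finset.mem_singleton, forall_eq, Finset.notMem_empty,
      IsEmpty.forall_iff, implies_true, if_true]
    cases u i <;> simp
  rw [h]
  exact Submodule.sub_mem _ (mono_mem_lowDeg (by simp)) (mono_mem_lowDeg (by simp))

/-- complementing the input does not raise the `𝔽_p`-degree of a strategy. -/
theorem hasDegF_complStrat {D : ℕ} {y : Fin (n + 1) → (Fin n → Bool) → Bool} (hy : ∀ g, HasDegF p (y g) D)
    (g : Fin (n + 1)) : HasDegF p (complStrat y g) D :=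
  hasDegF_complArg (hy g)

variable (p)

/-- hardness at the SINGLE charge class `c ≡ m + 1 (mod 3)`. -/
def OneHardR (m D : ℕ) (θ : ℝ) : Prop :=
  ∀ c : ℕ, c % 3 = (m + 1) % 3 → ∀ y : Fin (m + 1) → (Fin m → Bool) → Bool, (∀ g, HasDegF p (y g) D) →
    (winCount m c y : ℝ) ≤ θ * 2 ^ m

variable {p}

/-- **ONE CLASS SUFFICES**: hardness at `c ≡ m+1` gives hardness at both off-diagonal classes. -/
theorem offHardR_of_oneHardR {m D : ℕ} {θ : ℝ} (h : OneHardR p m D θ) : OffHardR p m D θ := by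
  intro c hc y hy
  by_cases h1 : c % 3 = (m + 1) % 3
  · exact h c h1 y hy
  · have hc3 : c % 3 = (m + 2) % 3 := by unfold OffDiag at hc; omega
    have h2 : (2 * c + 2 * m) % 3 = (m + 1) % 3 := by omega
    have h3 := h (2 * c + 2 * m) h2 (complStrat y) (hasDegF_complStrat hy)
    rw [winCount_complStrat, winCount_charge_mod (show (2 * (2 * c + 2 * m) + 2 * m) % 3 = c % 3 by omega)] at h3
    exact h3

/-- with the length law: ONE class at lengths `k+1, k` (degree `5D`) gives ALL charges at `k+2`. -/
theorem lengthLaw_one {k D : ℕ} {θ : ℝ} (h1 : OneHardR p (k + 1) (5 * D) θ) (h0 : OneHardR p k (5 * D) θ) :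
    HardR p (k + 2) D θ :=
  lengthLaw' (offHardR_of_oneHardR h1) (offHardR_of_oneHardR h0)

/-! ### The grades at ONE charge class -/

/-- Q₁: the quasi-loss grade asked only at `c ≡ n + 1 (mod 3)`. -/
def QuasiLossOne : Prop :=
  ∀ (p : ℕ) [Fact p.Prime], 5 ≤ p → ∃ A : ℕ, ∀ C : ℕ, ∃ n₀ : ℕ, ∀ n ≥ n₀, ∀ c : ℕ, c % 3 = (n + 1) % 3 →
    ∀ y : Fin (n + 1) → (Fin n → Bool) → Bool,
    (∀ g, Summit.QuantumAdvantage.AdviceFreeQNC0.HasDegF p (y g) ((Nat.log 2 n) ^ C)) →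
      ((Finset.univ.filter fun u : Fin n → Bool =>
        Summit.QuantumAdvantage.AdviceFreeQNC0.ringWinU c y u = true).card : ℝ)
        ≤ (1 - 1 / (2 : ℝ) ^ ((Nat.log 2 n) ^ A)) * (2 : ℝ) ^ n

/-- THE SHARP PIECE: the residual 28401 with its conclusion asked at ONE charge class. -/
def MassHiQuasiOne : Prop := QuarterFloor → QuasiLossOne

/-- Q_off ⟹ Q_one (restriction to the single class `c ≡ n+1`). -/
theorem quasiLossOne_of_off (h : QuasiLossOff) : QuasiLossOne := by
  intro p _ hp
  obtain ⟨A, hA⟩ := h p hp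
  refine ⟨A, fun C => ?_⟩
  obtain ⟨n₀, hn₀⟩ := hA C
  exact ⟨n₀, fun n hn c hc y hy => hn₀ n hn c (by omega) y hy⟩

/-- Q_one ⟹ Q_off (the class `c ≡ n+2` is the complement-dual of `c ≡ n+1`). -/
theorem quasiLossOff_of_one (h : QuasiLossOne) : QuasiLossOff := by
  intro p _ hp
  obtain ⟨A, hA⟩ := h p hp
  refine ⟨A, fun C => ?_⟩
  obtain ⟨n₀, hn₀⟩ := hA C
  refine ⟨n₀, fun n hn c hc y hy => ?_⟩
  have h1 : OneHardR p n (Nat.log 2 n ^ C) (1 - 1 / (2 : ℝ) ^ (Nat.log 2 n ^ A)) := by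
    intro c' hc' y' hy'
    simpa [winCount] using hn₀ n hn c' hc' y' hy'
  simpa [winCount] using offHardR_of_oneHardR h1 c hc y hy

/-- **Q ⟺ Q_one**: one charge class decides the quasi grade. -/
theorem quasiLoss_iff_one : QuasiLoss ↔ QuasiLossOne :=
  ⟨fun h => quasiLossOne_of_off (quasiLossOff_of_quasiLoss h),
   fun h => quasiLoss_of_off (quasiLossOff_of_one h)⟩

/-- X₁: no perfect polylog-degree strategy at the one class `c ≡ n + 1`. -/
def NoPerfectOne : Prop :=
  ∀ (p : ℕ) [Fact p.Prime], 5 ≤ p → ∀ C : ℕ, ∃ n₀ : ℕ, ∀ n ≥ n₀, ∀ c : ℕ, c % 3 = (n + 1) % 3 →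
    ∀ y : Fin (n + 1) → (Fin n → Bool) → Bool,
    (∀ g, Summit.QuantumAdvantage.AdviceFreeQNC0.HasDegF p (y g) ((Nat.log 2 n) ^ C)) →
      ∃ u, Summit.QuantumAdvantage.AdviceFreeQNC0.ringWinU c y u = false

/-- X_off ⟺ X_one (complement duality at the bottom rung). -/
theorem noPerfectOff_iff_one : NoPerfectOff ↔ NoPerfectOne := by
  constructor
  · intro h p _ hp C
    obtain ⟨n₀, hn₀⟩ := h p hp C
    exact ⟨n₀, fun n hn c hc y hy => hn₀ n hn c (by omega) y hy⟩
  · intro h p _ hp C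
    obtain ⟨n₀, hn₀⟩ := h p hp C
    refine ⟨n₀, fun n hn c hc y hy => ?_⟩
    by_cases h1 : c % 3 = (n + 1) % 3
    · exact hn₀ n hn c h1 y hy
    · have hc3 : c % 3 = (n + 2) % 3 := by omega
      have h2 : (2 * c + 2 * n) % 3 = (n + 1) % 3 := by omega
      obtain ⟨u, hu⟩ := hn₀ n hn (2 * c + 2 * n) h2 (complStrat y) (fun g => hasDegF_complStrat hy g)
      refine ⟨fun i => !u i, ?_⟩
      rw [ringWinU_complStrat]
      exact hu

/-- `WalkHardF p` at the one class. -/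
def WalkHardFOne (p : ℕ) [Fact p.Prime] : Prop :=
  ∃ θ : ℝ, θ < 1 ∧ ∀ C : ℕ, ∃ n₀ : ℕ, ∀ n ≥ n₀, ∀ c : ℕ, c % 3 = (n + 1) % 3 →
    ∀ y : Fin (n + 1) → (Fin n → Bool) → Bool,
    (∀ g, HasDegF p (y g) ((Nat.log 2 n) ^ C)) →
      ((univ.filter fun u : Fin n → Bool => ringWinU c y u = true).card : ℝ) ≤ θ * (2 : ℝ) ^ n

/-- `WalkHardFOff p ⟺ WalkHardFOne p` (complement duality at the leaf grade). -/
theorem walkHardFOff_iff_one (p : ℕ) [Fact p.Prime] : WalkHardFOff p ↔ WalkHardFOne p := by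
  constructor
  · rintro ⟨θ, hθ, h⟩
    refine ⟨θ, hθ, fun C => ?_⟩
    obtain ⟨n₀, hn₀⟩ := h C
    exact ⟨n₀, fun n hn c hc y hy => hn₀ n hn c (by omega) y hy⟩
  · rintro ⟨θ, hθ, h⟩
    refine ⟨θ, hθ, fun C => ?_⟩
    obtain ⟨n₀, hn₀⟩ := h C
    refine ⟨n₀, fun n hn c hc y hy => ?_⟩
    have h1 : OneHardR p n (Nat.log 2 n ^ C) θ := by
      intro c' hc' y' hy'
      simpa [winCount] using hn₀ n hn c' hc' y' hy'
    simpa [winCount] using offHardR_of_oneHardR h1 c hc y hy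

/-- **the leaf crux at one class**: `WalkHardF p ↔ WalkHardFOne p`. -/
theorem walkHardF_iff_one (p : ℕ) [Fact p.Prime] : WalkHardF p ↔ WalkHardFOne p :=
  (walkHardF_iff_off p).trans (walkHardFOff_iff_one p)

end Complement

end Summit.QuantumAdvantage.QuantumAdvantage.Theorems.LengthDial
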